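import Literature.MathematicalPhysics.QuantumLattice.HubbardTPPWeightedOpenBox
import Literature.MathematicalPhysics.QuantumLattice.HubbardTPPClusterFloorInfVol
import HarnessLib

/-!
# The WEIGHTED infinite-volume Anderson cluster floor for object M (`t–t'–t''–U`): kernel sector floors of ONE
# weighted open `2 × 3` cluster bound the fixed-filling energy density — exact in `t''`

Topic `MathematicalPhysics/QuantumLattice`, family `hubbard` (seat hubbard-box-p3, S2 CERTIFIER-FAMILIES,
hypothesis-free tier). The weighted twin of `HubbardTPPClusterFloorInfVol{,OneTable}` (box-p2's ACF-M law
`tiGroundEnergyDensityAt_tpp_ge_of_boxFloors_2x3_oneTable`, UNIFORM Anderson cover `(t/7, t'/4, t''/2, U/12)`) and the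
infinite-volume twin of `HubbardNNNHoppingWeightedClusterLowerBound` (weighted cover, torus route, `t'' = 0`).
Valentí–Stolze–Hirschfeld (1991, §II): the cluster decomposition stays exact when the lattice couplings are
distributed with POSITION-DEPENDENT weights over the covering clusters; with the `2 × 3` box and its transpose as
the two covering shapes the conditions are `wsumV τ + wsumH τ = t`, `2·wsumD₁ τ = 2·wsumD₂ τ = t'`,
`2·Σ υ = U`, `Σ ν = 0`, and a uniform third-neighbour weight `t''/2` (each third-neighbour bond of `ℤ²` has exactly
two covering placements, both in the orientation whose long side is parallel to it).

* §1 **translation-invariant two-point bookkeeping**: for a translation-invariant state `ω` and a region `Λ`,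
  the symmetrised hopping expectation between a site `a ∈ Λ` and `a + e_i` (resp. `a + j_s`) inside `𝔄_Λ` is
  MINUS the unit bond energy `K_i = ω(Φ^{1,0}{0, e_i})` (resp. `P_s = ω(Φ'^{1}{0, j_s})`); the double occupancy
  of a site is `D = ω(Φ^{0,1}{0})`, its density `ρ(ω)`.
* §2 **the weighted cluster in a translation-invariant state** (`re_expect_relabel_hubbardOpenBoxTT'W`): relabelled
  onto the rectangle `[0,q+1) ⊆ ℤ²`,
  `Re ω(Γ h^W) = wsumV τ·Re K₀ + wsumH τ·Re K₁ + wsumD₁ τ·Re P₀ + wsumD₂ τ·Re P₁ + (Σ υ)·Re D + (Σ ν)·ρ(ω)`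
  (the weighted bond count by direction `sum_ite_boxAdj_mul_eq_wsums` applied to the two-point function of `ω`);
  the axial part is read by `expect_axial2_localHamiltonian`.
* §3 **THE LAW** (`tiGroundEnergyDensityAt_tpp_ge_of_boxFloorsW_2x3`): under the cover conditions, ONE kernel table
  `σ_k ≤ E₀(hubbardOpenBoxTT'T''W 2 3 τ υ ν (t''/2), k)` (`k ≤ 12`) with one supporting line `m ≤ σ_k + μk` gives
  `2m − 12μρ ≤ e^M(t,t',t'',U; ρ)` at every `0 < ρ < 2` — the drop-in replacement of the uniform one-table law
  (`…_uniform` recovers it), EXACT in `t''`; and the `t'' = 0` bridge from a weighted `t–t'` table (`…_of_ttPrimeWTable`).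

References: P. W. Anderson, Phys. Rev. 83 (1951) 1260, eq. (2) [cite: Anderson1951, eq. (2)]; R. Valentí, J. Stolze,
P. J. Hirschfeld, Phys. Rev. B 43 (1991) 13743, §II [cite: ValentiStolzeHirschfeld1991, §II]; D. Ruelle, *Statistical
Mechanics: Rigorous Results* (1969), §3.4 [cite: Ruelle1969, §3.4]; O. Bratteli, D. W. Robinson, *OAQSM 2* (1997), §6.2.4
[cite: BratteliRobinsonII1997, §6.2.4 (Prop. 6.2.38 ff.)]; E. Pavarini et al., PRL 87 (2001) 047003, eq. (1)
[cite: PavariniEtAl2001, eq. (1)]. Everything is proved; no definition, no named fact, nothing numerical.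
-/

noncomputable section

namespace Literature.MathematicalPhysics.QuantumLattice

open Matrix Finset HubbardWave0 Literature.Probability.LatticeModels ThermodynamicLimit ClusterLowerBound
open scoped ComplexOrder

namespace InfVolFermionState

variable {ω : InfVolFermionState 2}

/-! ### §1 Translation-invariant two-point bookkeeping inside a region -/

/-- **Symmetrised nearest-neighbour hopping expectation = minus the unit bond energy**: for translation-invariant
`ω`, a site `a` of `Λ` and `a + e_i ∈ Λ`,
`Σ_σ [ω(c†_{aσ} c_{a+e_i,σ}) + ω(c†_{a+e_i,σ} c_{aσ})] = -ω(Φ^{1,0}{0, e_i})` (expectations in `𝔄_Λ`).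
[cite: BratteliRobinsonII1997, §6.2.4 (Prop. 6.2.38 ff.)] -/
theorem IsTranslationInvariant.sum_expect_hop_pair_unitVec (hω : ω.IsTranslationInvariant) {Λ : Finset (Site 2)}
    (a : PolySite Λ) (i : Fin 2) (h' : ofLex a.1 + unitVec i ∈ Λ) :
    ∑ σ : Fin 2, (ω.expect Λ (creation (orb a σ) * annihilation (orb (PolySite.pt (ofLex a.1 + unitVec i) h') σ)) +
        ω.expect Λ (creation (orb (PolySite.pt (ofLex a.1 + unitVec i) h') σ) * annihilation (orb a σ))) =
      -ω.expect {0, 0 + unitVec i} ((hubbardFermionInteraction 2 1 0).Φ {0, 0 + unitVec i}) := by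
  have hS : ({ofLex a.1, ofLex a.1 + unitVec i} : Finset (Site 2)) ⊆ Λ :=
    insert_subset (PolySite.ofLex_mem a) (singleton_subset_iff.2 h')
  set K := ω.expect {0, 0 + unitVec i} ((hubbardFermionInteraction 2 1 0).Φ {0, 0 + unitVec i}) with hK
  have h1 := hω.expect_hubbard_pair 1 0 (ofLex a.1) i
  rw [← hK, ← ω.compatible hS] at h1
  simp only [hubbardFermionInteraction_apply_pair, Complex.ofReal_one, map_smul, map_sum, map_add, map_mul, cAt,
    annihilation_conjTranspose, fermionEmbed_creation, fermionEmbed_annihilation, PolySite.incl_pt, smul_eq_mul] at h1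
  rw [← h1]
  simp only [neg_mul, one_mul, neg_neg]
  rfl

/-- **Symmetrised diagonal hopping expectation = minus the unit diagonal bond energy**:
`Σ_σ [ω(c†_{aσ} c_{a+j_s,σ}) + ω(c†_{a+j_s,σ} c_{aσ})] = -ω(Φ'^{1}{0, j_s})`. [cite: BratteliRobinsonII1997, §6.2.4 (Prop. 6.2.38 ff.)] -/
theorem IsTranslationInvariant.sum_expect_hop_pair_diagVec (hω : ω.IsTranslationInvariant) {Λ : Finset (Site 2)}
    (a : PolySite Λ) (s : Fin 2) (h' : ofLex a.1 + diagVec s ∈ Λ) :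
    ∑ σ : Fin 2, (ω.expect Λ (creation (orb a σ) * annihilation (orb (PolySite.pt (ofLex a.1 + diagVec s) h') σ)) +
        ω.expect Λ (creation (orb (PolySite.pt (ofLex a.1 + diagVec s) h') σ) * annihilation (orb a σ))) =
      -ω.expect {0, 0 + diagVec s} ((diagHoppingFermionInteraction 1).Φ {0, 0 + diagVec s}) := by
  have hS : ({ofLex a.1, ofLex a.1 + diagVec s} : Finset (Site 2)) ⊆ Λ :=
    insert_subset (PolySite.ofLex_mem a) (singleton_subset_iff.2 h')
  set K := ω.expect {0, 0 + diagVec s} ((diagHoppingFermionInteraction 1).Φ {0, 0 + diagVec s}) with hK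
  have h1 := hω.expect_diagHopping_pair 1 (ofLex a.1) s
  rw [← hK, ← ω.compatible hS] at h1
  simp only [diagHoppingFermionInteraction_apply_pair, Complex.ofReal_one, map_smul, map_sum, map_add, map_mul, cAt,
    annihilation_conjTranspose, fermionEmbed_creation, fermionEmbed_annihilation, PolySite.incl_pt, smul_eq_mul] at h1
  rw [← h1]
  simp only [neg_mul, one_mul, neg_neg]
  rfl

/-- **Double occupancy of a site = the unit on-site energy**: `ω(n_{a↑} n_{a↓}) = ω(Φ^{0,1}{0})` for translation-invariant
`ω` (expectation in `𝔄_Λ`). [cite: BratteliRobinsonI1987, §4.3.1] -/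
theorem IsTranslationInvariant.expect_numberOp_mul_numberOp (hω : ω.IsTranslationInvariant) {Λ : Finset (Site 2)}
    (a : PolySite Λ) :
    ω.expect Λ (numberOp a 0 * numberOp a 1) = ω.expect {0} ((hubbardFermionInteraction 2 0 1).Φ {0}) := by
  have hS : ({ofLex a.1} : Finset (Site 2)) ⊆ Λ := singleton_subset_iff.2 (PolySite.ofLex_mem a)
  set D := ω.expect {0} ((hubbardFermionInteraction 2 0 1).Φ {0}) with hD
  have h1 := hω.expect_hubbard_singleton 0 1 (ofLex a.1)
  rw [← hD, ← ω.compatible hS] at h1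
  simp only [hubbardFermionInteraction_apply_singleton, Complex.ofReal_one, one_smul, nAt, fermionEmbed_mul,
    fermionEmbed_numberOp, PolySite.incl_pt] at h1
  rw [← h1]
  rfl

/-- **Site density inside a region**: `Re ω(n_{a↑} + n_{a↓}) = ρ(ω)` for translation-invariant `ω`.
[cite: BratteliRobinsonI1987, §4.3.1] -/
theorem IsTranslationInvariant.re_expect_numberOp_add (hω : ω.IsTranslationInvariant) {Λ : Finset (Site 2)}
    (a : PolySite Λ) : (ω.expect Λ (numberOp a 0 + numberOp a 1)).re = ω.density := by
  have hx := PolySite.ofLex_mem a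
  have hcomp : ∀ σ : Fin 2, ω.expect Λ (numberOp a σ) =
      ω.expect {ofLex a.1} (nAt (ofLex a.1) (mem_singleton_self _) σ) := by
    intro σ
    rw [← ω.compatible (singleton_subset_iff.2 hx) (nAt (ofLex a.1) (mem_singleton_self _) σ), nAt,
      fermionEmbed_numberOp, PolySite.incl_pt]
    rfl
  rw [map_add, hcomp 0, hcomp 1, ← map_add, ← hω.densityAt_eq_density (ofLex a.1), InfVolFermionState.densityAt]

/-! ### §2 The weighted cluster relabelled onto a rectangle, in a translation-invariant state -/

/-- `relabel e 1 = 1`, generic rewriting form (at concrete orbital types `map_one` would have to re-synthesise the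
matrix-algebra instances). [folklore] -/
private theorem relabel_one'' {ι ι' : Type*} [LinearOrder ι] [Fintype ι] [LinearOrder ι'] [Fintype ι']
    (e : ι ≃ ι') : relabel e (1 : Matrix (Finset ι) (Finset ι) ℂ) = 1 :=
  map_one (relabel e)

/-- Equality of sites of `ℤ²` is equality of both coordinates. [folklore] -/
private theorem site_two_eq_iff' (x y : Site 2) : x = y ↔ x 0 = y 0 ∧ x 1 = y 1 := by
  refine ⟨fun h => ⟨by rw [h], by rw [h]⟩, fun h => funext fun i => ?_⟩
  rcases fin_two_eq_zero_or_one i with rfl | rfl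
  exacts [h.1, h.2]

section Rect

variable (q : Fin 2 → ℕ) {r c : ℕ} (hr : r = q 0 + 1) (hc : c = q 1 + 1) (f : PolySite (halfOpenRect q) ≃ Fin r ×ₗ Fin c)
  (hf0 : ∀ a, (((ofLex (f a)).1 : ℕ) : ℤ) = ofLex a.1 0) (hf1 : ∀ a, (((ofLex (f a)).2 : ℕ) : ℤ) = ofLex a.1 1)

include hf0 hf1

/-- Coordinates of the site of `[0,q+1)` labelled by a cluster site. [folklore] -/
private theorem symm_coord (p : Fin r ×ₗ Fin c) :
    ofLex (f.symm p).1 0 = ((ofLex p).1 : ℕ) ∧ ofLex (f.symm p).1 1 = ((ofLex p).2 : ℕ) := by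
  constructor
  · have h := hf0 (f.symm p); rw [Equiv.apply_symm_apply] at h; exact h.symm
  · have h := hf1 (f.symm p); rw [Equiv.apply_symm_apply] at h; exact h.symm

/-- `+e₁` steps of the cluster are `+e₁` steps of `ℤ²`. [cite: LeBlancEtAl2015, eq. (1)] -/
private theorem symm_eq_add_of_stepV {p p' : Fin r ×ₗ Fin c}
    (h : ((ofLex p).1 : ℕ) + 1 = (ofLex p').1 ∧ (ofLex p).2 = (ofLex p').2) :
    ofLex (f.symm p').1 = ofLex (f.symm p).1 + unitVec 0 := by
  obtain ⟨h0, h1⟩ := symm_coord q f hf0 hf1 p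
  obtain ⟨h0', h1'⟩ := symm_coord q f hf0 hf1 p'
  have h2 := congrArg Fin.val h.2
  rw [site_two_eq_iff', Pi.add_apply, Pi.add_apply, h0, h1, h0', h1']
  simp only [unitVec, Pi.single_eq_same, Pi.single_eq_of_ne (one_ne_zero : (1 : Fin 2) ≠ 0)]
  constructor <;> omega

/-- `+e₂` steps of the cluster are `+e₂` steps of `ℤ²`. [cite: LeBlancEtAl2015, eq. (1)] -/
private theorem symm_eq_add_of_stepH {p p' : Fin r ×ₗ Fin c}
    (h : (ofLex p).1 = (ofLex p').1 ∧ ((ofLex p).2 : ℕ) + 1 = (ofLex p').2) :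
    ofLex (f.symm p').1 = ofLex (f.symm p).1 + unitVec 1 := by
  obtain ⟨h0, h1⟩ := symm_coord q f hf0 hf1 p
  obtain ⟨h0', h1'⟩ := symm_coord q f hf0 hf1 p'
  have h2 := congrArg Fin.val h.1
  rw [site_two_eq_iff', Pi.add_apply, Pi.add_apply, h0, h1, h0', h1']
  simp only [unitVec, Pi.single_eq_same, Pi.single_eq_of_ne (zero_ne_one : (0 : Fin 2) ≠ 1)]
  constructor <;> omega

/-- `+(e₁ + e₂)` steps of the cluster are `+j₀` steps of `ℤ²`. [cite: LeBlancEtAl2015, eq. (1)] -/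
private theorem symm_eq_add_of_stepD₁ {p p' : Fin r ×ₗ Fin c}
    (h : ((ofLex p).1 : ℕ) + 1 = (ofLex p').1 ∧ ((ofLex p).2 : ℕ) + 1 = (ofLex p').2) :
    ofLex (f.symm p').1 = ofLex (f.symm p).1 + diagVec 0 := by
  obtain ⟨h0, h1⟩ := symm_coord q f hf0 hf1 p
  obtain ⟨h0', h1'⟩ := symm_coord q f hf0 hf1 p'
  rw [site_two_eq_iff', Pi.add_apply, Pi.add_apply, h0, h1, h0', h1', diagVec_apply_zero, diagVec_apply_one,
    if_pos rfl]
  constructor <;> omega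

/-- `+(e₁ - e₂)` steps of the cluster are `+j₁` steps of `ℤ²`. [cite: LeBlancEtAl2015, eq. (1)] -/
private theorem symm_eq_add_of_stepD₂ {p p' : Fin r ×ₗ Fin c}
    (h : ((ofLex p).1 : ℕ) + 1 = (ofLex p').1 ∧ ((ofLex p').2 : ℕ) + 1 = (ofLex p).2) :
    ofLex (f.symm p').1 = ofLex (f.symm p).1 + diagVec 1 := by
  obtain ⟨h0, h1⟩ := symm_coord q f hf0 hf1 p
  obtain ⟨h0', h1'⟩ := symm_coord q f hf0 hf1 p'
  rw [site_two_eq_iff', Pi.add_apply, Pi.add_apply, h0, h1, h0', h1', diagVec_apply_zero, diagVec_apply_one,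
    if_neg (show (1 : Fin 2) ≠ 0 by decide)]
  constructor <;> omega

/-- **THE WEIGHTED `t–t'–U` CLUSTER IN A TRANSLATION-INVARIANT STATE.** Relabelled onto the rectangle
`[0,q+1) ⊆ ℤ²` along the coordinate bijection `f`, the weighted open cluster `h^W = hubbardOpenBoxTT'W (q₀+1) (q₁+1) τ υ ν`
(`τ` symmetric) has, in every translation-invariant `ω`,
`Re ω(Γ_{f⁻¹} h^W) = wsumV τ·Re K₀ + wsumH τ·Re K₁ + wsumD₁ τ·Re P₀ + wsumD₂ τ·Re P₁ + (Σ υ)·Re D + (Σ ν)·ρ(ω)`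
with the unit bond / diagonal-bond / on-site energies `K_i = ω(Φ^{1,0}{0,e_i})`, `P_s = ω(Φ'^{1}{0,j_s})`, `D = ω(Φ^{0,1}{0})`.
[cite: ValentiStolzeHirschfeld1991, §II] [cite: BratteliRobinsonII1997, §6.2.4 (Prop. 6.2.38 ff.)] -/
theorem IsTranslationInvariant.re_expect_relabel_hubbardOpenBoxTT'W (hω : ω.IsTranslationInvariant)
    (τ : Fin r ×ₗ Fin c → Fin r ×ₗ Fin c → ℝ) (hτ : ∀ x y, τ x y = τ y x)
    (υ ν : Fin r ×ₗ Fin c → ℝ) :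
    (ω.expect (halfOpenRect q) (relabel (Orb.mapEquiv f.symm) (hubbardOpenBoxTT'W r c τ υ ν))).re =
      wsumV τ * (ω.expect {0, 0 + unitVec 0} ((hubbardFermionInteraction 2 1 0).Φ {0, 0 + unitVec 0})).re +
        wsumH τ * (ω.expect {0, 0 + unitVec 1} ((hubbardFermionInteraction 2 1 0).Φ {0, 0 + unitVec 1})).re +
        wsumD₁ τ * (ω.expect {0, 0 + diagVec 0} ((diagHoppingFermionInteraction 1).Φ {0, 0 + diagVec 0})).re +
        wsumD₂ τ * (ω.expect {0, 0 + diagVec 1} ((diagHoppingFermionInteraction 1).Φ {0, 0 + diagVec 1})).re +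
        (∑ x, υ x) * (ω.expect {0} ((hubbardFermionInteraction 2 0 1).Φ {0})).re +
        (∑ x, ν x) * ω.density := by
  classical
  set K0 := ω.expect {0, 0 + unitVec 0} ((hubbardFermionInteraction 2 1 0).Φ {0, 0 + unitVec 0}) with hK0
  set K1 := ω.expect {0, 0 + unitVec 1} ((hubbardFermionInteraction 2 1 0).Φ {0, 0 + unitVec 1}) with hK1
  set P0 := ω.expect {0, 0 + diagVec 0} ((diagHoppingFermionInteraction 1).Φ {0, 0 + diagVec 0}) with hP0
  set P1 := ω.expect {0, 0 + diagVec 1} ((diagHoppingFermionInteraction 1).Φ {0, 0 + diagVec 1}) with hP1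
  set D := ω.expect {0} ((hubbardFermionInteraction 2 0 1).Φ {0}) with hD
  -- the relabelled cluster, generator by generator
  have hrel : relabel (Orb.mapEquiv f.symm) (hubbardOpenBoxTT'W r c τ υ ν) =
      -(∑ p : Fin r ×ₗ Fin c, ∑ p' : Fin r ×ₗ Fin c, ∑ σ : Fin 2,
          if (rectBoxGraph r c).Adj p p' ∨ (rectBoxDiagGraph r c).Adj p p' then
            ((τ p p' : ℝ) : ℂ) • (creation (orb (f.symm p) σ) * annihilation (orb (f.symm p') σ) : FermionOp (halfOpenRect q)) else 0) +
        ∑ p : Fin r ×ₗ Fin c, ((υ p : ℝ) : ℂ) • (numberOp (f.symm p) 0 * numberOp (f.symm p) 1 : FermionOp (halfOpenRect q)) +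
        ∑ p : Fin r ×ₗ Fin c, ((ν p : ℝ) : ℂ) • (numberOp (f.symm p) 0 + numberOp (f.symm p) 1 : FermionOp (halfOpenRect q)) := by
    unfold hubbardOpenBoxTT'W
    rw [map_add, map_add, map_neg, map_sum, map_sum, map_sum]
    congr 1
    congr 1
    · congr 1
      refine Finset.sum_congr rfl fun p _ => ?_
      rw [map_sum]
      refine Finset.sum_congr rfl fun p' _ => ?_
      rw [map_sum]
      refine Finset.sum_congr rfl fun σ _ => ?_
      split_ifs
      · rw [map_smul, map_mul, relabel_creation, relabel_annihilation, Orb.mapEquiv_orb, Orb.mapEquiv_orb]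
      · rw [map_zero]
    · refine Finset.sum_congr rfl fun p _ => ?_
      rw [map_smul, map_mul, relabel_mapEquiv_numberOp, relabel_mapEquiv_numberOp]
    · refine Finset.sum_congr rfl fun p _ => ?_
      rw [map_smul, map_add, relabel_mapEquiv_numberOp, relabel_mapEquiv_numberOp]
  -- the symmetrised two-point function on the four directions
  have hV : ∀ p p' : Fin r ×ₗ Fin c, ((ofLex p).1 : ℕ) + 1 = (ofLex p').1 ∧ (ofLex p).2 = (ofLex p').2 →
      (∑ σ : Fin 2, ω.expect (halfOpenRect q) (creation (orb (f.symm p) σ) * annihilation (orb (f.symm p') σ))) +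
        (∑ σ : Fin 2, ω.expect (halfOpenRect q) (creation (orb (f.symm p') σ) * annihilation (orb (f.symm p) σ))) = -K0 := by
    intro p p' h
    have hv := symm_eq_add_of_stepV q f hf0 hf1 h
    have h' : ofLex (f.symm p).1 + unitVec 0 ∈ halfOpenRect q := hv ▸ PolySite.ofLex_mem (f.symm p')
    have hb : f.symm p' = PolySite.pt (ofLex (f.symm p).1 + unitVec 0) h' := Subtype.ext (congrArg toLex hv)
    rw [hb, ← Finset.sum_add_distrib]
    exact hω.sum_expect_hop_pair_unitVec (f.symm p) 0 h'
  have hH : ∀ p p' : Fin r ×ₗ Fin c, (ofLex p).1 = (ofLex p').1 ∧ ((ofLex p).2 : ℕ) + 1 = (ofLex p').2 →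
      (∑ σ : Fin 2, ω.expect (halfOpenRect q) (creation (orb (f.symm p) σ) * annihilation (orb (f.symm p') σ))) +
        (∑ σ : Fin 2, ω.expect (halfOpenRect q) (creation (orb (f.symm p') σ) * annihilation (orb (f.symm p) σ))) = -K1 := by
    intro p p' h
    have hv := symm_eq_add_of_stepH q f hf0 hf1 h
    have h' : ofLex (f.symm p).1 + unitVec 1 ∈ halfOpenRect q := hv ▸ PolySite.ofLex_mem (f.symm p')
    have hb : f.symm p' = PolySite.pt (ofLex (f.symm p).1 + unitVec 1) h' := Subtype.ext (congrArg toLex hv)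
    rw [hb, ← Finset.sum_add_distrib]
    exact hω.sum_expect_hop_pair_unitVec (f.symm p) 1 h'
  have hD₁ : ∀ p p' : Fin r ×ₗ Fin c,
      ((ofLex p).1 : ℕ) + 1 = (ofLex p').1 ∧ ((ofLex p).2 : ℕ) + 1 = (ofLex p').2 →
      (∑ σ : Fin 2, ω.expect (halfOpenRect q) (creation (orb (f.symm p) σ) * annihilation (orb (f.symm p') σ))) +
        (∑ σ : Fin 2, ω.expect (halfOpenRect q) (creation (orb (f.symm p') σ) * annihilation (orb (f.symm p) σ))) = -P0 := by
    intro p p' h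
    have hv := symm_eq_add_of_stepD₁ q f hf0 hf1 h
    have h' : ofLex (f.symm p).1 + diagVec 0 ∈ halfOpenRect q := hv ▸ PolySite.ofLex_mem (f.symm p')
    have hb : f.symm p' = PolySite.pt (ofLex (f.symm p).1 + diagVec 0) h' := Subtype.ext (congrArg toLex hv)
    rw [hb, ← Finset.sum_add_distrib]
    exact hω.sum_expect_hop_pair_diagVec (f.symm p) 0 h'
  have hD₂ : ∀ p p' : Fin r ×ₗ Fin c,
      ((ofLex p).1 : ℕ) + 1 = (ofLex p').1 ∧ ((ofLex p').2 : ℕ) + 1 = (ofLex p).2 →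
      (∑ σ : Fin 2, ω.expect (halfOpenRect q) (creation (orb (f.symm p) σ) * annihilation (orb (f.symm p') σ))) +
        (∑ σ : Fin 2, ω.expect (halfOpenRect q) (creation (orb (f.symm p') σ) * annihilation (orb (f.symm p) σ))) = -P1 := by
    intro p p' h
    have hv := symm_eq_add_of_stepD₂ q f hf0 hf1 h
    have h' : ofLex (f.symm p).1 + diagVec 1 ∈ halfOpenRect q := hv ▸ PolySite.ofLex_mem (f.symm p')
    have hb : f.symm p' = PolySite.pt (ofLex (f.symm p).1 + diagVec 1) h' := Subtype.ext (congrArg toLex hv)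
    rw [hb, ← Finset.sum_add_distrib]
    exact hω.sum_expect_hop_pair_diagVec (f.symm p) 1 h'
  have key := sum_ite_boxAdj_mul_eq_wsums τ hτ
    (fun p p' : Fin r ×ₗ Fin c =>
      ∑ σ : Fin 2, ω.expect (halfOpenRect q) (creation (orb (f.symm p) σ) * annihilation (orb (f.symm p') σ))) hV hH hD₁ hD₂
  beta_reduce at key
  -- the hopping part
  have hhop : ω.expect (halfOpenRect q) (∑ p : Fin r ×ₗ Fin c, ∑ p' : Fin r ×ₗ Fin c, ∑ σ : Fin 2,
      if (rectBoxGraph r c).Adj p p' ∨ (rectBoxDiagGraph r c).Adj p p' then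
        ((τ p p' : ℝ) : ℂ) • (creation (orb (f.symm p) σ) * annihilation (orb (f.symm p') σ) : FermionOp (halfOpenRect q)) else 0) =
      (wsumV τ : ℂ) * -K0 + (wsumH τ : ℂ) * -K1 + (wsumD₁ τ : ℂ) * -P0 + (wsumD₂ τ : ℂ) * -P1 := by
    rw [← key, map_sum]
    refine Finset.sum_congr rfl fun p _ => ?_
    rw [map_sum]
    refine Finset.sum_congr rfl fun p' _ => ?_
    rw [map_sum]
    by_cases h : (rectBoxGraph r c).Adj p p' ∨ (rectBoxDiagGraph r c).Adj p p'
    · simp only [if_pos h, map_smul, smul_eq_mul, Finset.mul_sum]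
    · simp only [if_neg h, map_zero, Finset.sum_const_zero]
  -- the repulsion part
  have hU : ω.expect (halfOpenRect q) (∑ p : Fin r ×ₗ Fin c,
      ((υ p : ℝ) : ℂ) • (numberOp (f.symm p) 0 * numberOp (f.symm p) 1 : FermionOp (halfOpenRect q))) = ((∑ x, υ x : ℝ) : ℂ) * D := by
    rw [map_sum, Complex.ofReal_sum, Finset.sum_mul]
    refine Finset.sum_congr rfl fun p _ => ?_
    rw [map_smul, smul_eq_mul, hω.expect_numberOp_mul_numberOp (f.symm p)]
  -- the potential part (real parts)
  have hN : (ω.expect (halfOpenRect q) (∑ p : Fin r ×ₗ Fin c,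
      ((ν p : ℝ) : ℂ) • (numberOp (f.symm p) 0 + numberOp (f.symm p) 1 : FermionOp (halfOpenRect q)))).re = (∑ x, ν x) * ω.density := by
    rw [map_sum, Complex.re_sum, Finset.sum_mul]
    refine Finset.sum_congr rfl fun p _ => ?_
    rw [map_smul, smul_eq_mul, Complex.re_ofReal_mul, hω.re_expect_numberOp_add (f.symm p)]
  rw [hrel, map_add, map_add, map_neg, Complex.add_re, Complex.add_re, Complex.neg_re, hhop, hU, hN]
  simp only [Complex.add_re, mul_neg, Complex.neg_re, Complex.re_ofReal_mul]
  ring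

include hr hc in
/-- **The axial part relabelled**: `Γ_{f⁻¹}(hamiltonian (rectBoxAxial2Graph (q₀+1) (q₁+1)) a 0) = H^{Φ''(a)}_{[0,q+1)}`, the
free-boundary box Hamiltonian of the third-neighbour hopping interaction. [cite: PavariniEtAl2001, eq. (1)] -/
theorem relabel_symm_hamiltonian_rectBoxAxial2Graph_eq_localHamiltonian (a : ℝ) :
    relabel (Orb.mapEquiv f.symm) (hamiltonian (rectBoxAxial2Graph r c) a 0) =
      ((axialRange2HoppingFermionInteraction 2 a).localHamiltonian (halfOpenRect q) : FermionOp (halfOpenRect q)) := by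
  classical
  subst hr hc
  rw [axialRange2Hopping_localHamiltonian_eq_hamiltonian a (halfOpenRect q)
      ((rectBoxAxial2Graph (q 0 + 1) (q 1 + 1)).comap f) (fun a b => rectBoxAxial2Graph_adj_iff_axial2Adj_rect q f hf0 hf1 a b),
    relabel_hamiltonian (rectBoxAxial2Graph (q 0 + 1) (q 1 + 1)) ((rectBoxAxial2Graph (q 0 + 1) (q 1 + 1)).comap f) f.symm
      (fun x y => by rw [SimpleGraph.comap_adj, Equiv.apply_symm_apply, Equiv.apply_symm_apply]) a 0]

include hr hc in
/-- **KERNEL SECTOR FLOORS OF THE WEIGHTED CLUSTER ⇒ A FLOOR FOR EVERY STATE on `[0, q+1)`**: sector floors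
`σ_k ≤ E₀(hubbardOpenBoxTT'T''W (q₀+1) (q₁+1) τ υ ν a, k)` and one supporting line `m ≤ σ_k + μk` give, for EVERY
infinite-volume state `ω`: `m ≤ Re ω(Γ_{f⁻¹} h^W) + Re ω(H^{Φ''(a)}_{[0,q+1)}) + μ · Re ω(N_{[0,q+1)})`.
[cite: Anderson1951, eq. (2)] [cite: BratteliRobinsonI1987, Prop. 2.3.11] -/
theorem le_re_expect_relabel_tppW_of_sectorFloors (ω : InfVolFermionState 2)
    (τ : Fin r ×ₗ Fin c → Fin r ×ₗ Fin c → ℝ) (hτ : ∀ x y, τ x y = τ y x)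
    (υ ν : Fin r ×ₗ Fin c → ℝ) (a : ℝ) {σ : ℕ → ℝ}
    (hF : ∀ k ≤ 2 * (r * c), σ k ≤ groundEnergy (hubbardOpenBoxTT'T''W r c τ υ ν a) k)
    (μ m : ℝ) (hm : ∀ k ≤ 2 * (r * c), m ≤ σ k + μ * k) :
    m ≤ (ω.expect (halfOpenRect q) (relabel (Orb.mapEquiv f.symm) (hubbardOpenBoxTT'W r c τ υ ν))).re +
      (ω.expect (halfOpenRect q) ((axialRange2HoppingFermionInteraction 2 a).localHamiltonian (halfOpenRect q))).re +
      μ * (ω.expect (halfOpenRect q) (totalNumber : FermionOp (halfOpenRect q))).re := by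
  classical
  have hcard : Fintype.card (Fin r ×ₗ Fin c) = r * c := by
    rw [Fintype.card_lex, Fintype.card_prod, Fintype.card_fin, Fintype.card_fin]
  have hpsd := posSemidef_add_smul_totalNumber_sub_of_forall_le_groundEnergy
    (hubbardOpenBoxTT'T''W_isHermitian τ hτ υ ν a) (hubbardOpenBoxTT'T''W_commute_totalNumber τ υ ν a) (m := m) (μ := μ)
    (fun N hN => by
      rw [hcard] at hN
      exact (hm N hN).trans (by linarith [hF N hN]))
  have hrel := posSemidef_relabel (Orb.mapEquiv f.symm) hpsd
  rw [map_sub, map_add, map_smul, map_smul, relabel_mapEquiv_totalNumber, relabel_one'', hubbardOpenBoxTT'T''W_def, map_add,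
    relabel_symm_hamiltonian_rectBoxAxial2Graph_eq_localHamiltonian q hr hc f hf0 hf1] at hrel
  have h := ω.le_re_expect_add_of_posSemidef (halfOpenRect q) hrel
  rw [map_add, Complex.add_re] at h
  exact h

end Rect

/-! ### §3 The law: one weighted `2 × 3` table ⇒ a floor on object M, exact in `t''` -/

/-- Translate count inside the rectangle (kernel `decide`). [folklore] -/
private theorem card_rect32' : (halfOpenRect ![2, 1]).card = 6 := by decide
/-- Translate count inside the rectangle (kernel `decide`). [folklore] -/
private theorem cnt32_a0' : ((halfOpenRect ![2, 1]).filter (fun x => x + axial2Vec 0 ∈ halfOpenRect ![2, 1])).card = 2 := by decide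
/-- Translate count inside the rectangle (kernel `decide`). [folklore] -/
private theorem cnt32_a1' : ((halfOpenRect ![2, 1]).filter (fun x => x + axial2Vec 1 ∈ halfOpenRect ![2, 1])).card = 0 := by decide
/-- Translate count inside the rectangle (kernel `decide`). [folklore] -/
private theorem card_rect23' : (halfOpenRect ![1, 2]).card = 6 := by decide
/-- Translate count inside the rectangle (kernel `decide`). [folklore] -/
private theorem cnt23_a0' : ((halfOpenRect ![1, 2]).filter (fun x => x + axial2Vec 0 ∈ halfOpenRect ![1, 2])).card = 0 := by decide
/-- Translate count inside the rectangle (kernel `decide`). [folklore] -/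
private theorem cnt23_a1' : ((halfOpenRect ![1, 2]).filter (fun x => x + axial2Vec 1 ∈ halfOpenRect ![1, 2])).card = 2 := by decide

/-- Sums over the `c × r` box re-indexed over the `r × c` box. [folklore] -/
private theorem sum_rectSwap' {r c : ℕ} (g : Fin c ×ₗ Fin r → ℝ) :
    ∑ p : Fin c ×ₗ Fin r, g p = ∑ p : Fin r ×ₗ Fin c, g (rectSwap r c p) :=
  (Fintype.sum_equiv (rectSwap r c) _ _ fun _ => rfl).symm

/-- **THE WEIGHTED INFINITE-VOLUME ANDERSON CLUSTER FLOOR FOR OBJECT M (one table).** Let `τ` be symmetric bond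
weights, `υ` site repulsions and `ν` on-site potentials on the open `2 × 3` box with
`wsumV τ + wsumH τ = t`, `2·wsumD₁ τ = t'`, `2·wsumD₂ τ = t'`, `2·Σ υ = U`, `Σ ν = 0`. ONE kernel table of sector
floors of the weighted `t–t'–t''` cluster with axial weight `t''/2`, `σ_k ≤ E₀(hubbardOpenBoxTT'T''W 2 3 τ υ ν (t''/2), k)`
(`k ≤ 12`), and one supporting line `m ≤ σ_k + μk` give `2m − 12μρ ≤ e^M(t,t',t'',U; ρ)` at every density `0 < ρ < 2`
— the translates of the box and of its transpose (same table, `groundEnergy_hubbardOpenBoxTT'T''W_swap`) cover every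
nearest-neighbour bond with total weight `wsumV + wsumH`, every diagonal bond with `2·wsumD`, every third-neighbour bond
exactly twice, every site with `2·Σ υ` (and `2·Σ ν = 0`). EXACT in `t''`; `…_uniform` weights give the uniform law.
[cite: Anderson1951, eq. (2)] [cite: ValentiStolzeHirschfeld1991, §II] [cite: Ruelle1969, §3.4] -/
theorem tiGroundEnergyDensityAt_tpp_ge_of_boxFloorsW_2x3 {σ : ℕ → ℝ} {τ : Fin 2 ×ₗ Fin 3 → Fin 2 ×ₗ Fin 3 → ℝ}
    {υ ν : Fin 2 ×ₗ Fin 3 → ℝ} {t t' t'' U : ℝ} (hτ : ∀ x y, τ x y = τ y x) (ht : wsumV τ + wsumH τ = t)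
    (hD₁ : 2 * wsumD₁ τ = t') (hD₂ : 2 * wsumD₂ τ = t') (hU : 2 * ∑ x, υ x = U) (hν : ∑ x, ν x = 0)
    (hF : ∀ k ≤ 12, σ k ≤ groundEnergy (hubbardOpenBoxTT'T''W 2 3 τ υ ν (t'' / 2)) k)
    (μ m : ℝ) (hm : ∀ k ≤ 12, m ≤ σ k + μ * k) {ρ : ℝ} (hρ0 : 0 < ρ) (hρ2 : ρ < 2) :
    2 * m - 12 * μ * ρ ≤ (hubbardTT'T''FermionInteraction t t' t'' U).tiGroundEnergyDensityAt 2 ρ := by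
  classical
  subst ht hD₁ hU
  refine (hubbardTT'T''FermionInteraction (wsumV τ + wsumH τ) (2 * wsumD₁ τ) t'' (2 * ∑ x, υ x)).le_tiGroundEnergyDensityAt 2
    (exists_isTranslationInvariant_density_eq hρ0 hρ2) fun ω hω hρ => ?_
  -- the transposed weights for the `3 × 2` orientation share the table
  have hτ's : ∀ x y : Fin 3 ×ₗ Fin 2, (fun p p' : Fin 3 ×ₗ Fin 2 => τ (rectSwap 3 2 p) (rectSwap 3 2 p')) x y =
      (fun p p' : Fin 3 ×ₗ Fin 2 => τ (rectSwap 3 2 p) (rectSwap 3 2 p')) y x := fun x y => hτ _ _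
  have hF' : ∀ k ≤ 12, σ k ≤ groundEnergy (hubbardOpenBoxTT'T''W 3 2 (fun p p' => τ (rectSwap 3 2 p) (rectSwap 3 2 p'))
      (fun p => υ (rectSwap 3 2 p)) (fun p => ν (rectSwap 3 2 p)) (t'' / 2)) k := fun k hk => by
    rw [groundEnergy_hubbardOpenBoxTT'T''W_swap]; exact hF k hk
  -- the two local floors
  obtain ⟨f, hf0, hf1⟩ : ∃ f : PolySite (halfOpenRect ![1, 2]) ≃ Fin 2 ×ₗ Fin 3,
      (∀ a, (((ofLex (f a)).1 : ℕ) : ℤ) = ofLex a.1 0) ∧ (∀ a, (((ofLex (f a)).2 : ℕ) : ℤ) = ofLex a.1 1) :=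
    exists_equiv_polySite_halfOpenRect_two ![1, 2]
  obtain ⟨g, hg0, hg1⟩ : ∃ g : PolySite (halfOpenRect ![2, 1]) ≃ Fin 3 ×ₗ Fin 2,
      (∀ a, (((ofLex (g a)).1 : ℕ) : ℤ) = ofLex a.1 0) ∧ (∀ a, (((ofLex (g a)).2 : ℕ) : ℤ) = ofLex a.1 1) :=
    exists_equiv_polySite_halfOpenRect_two ![2, 1]
  have h1 := le_re_expect_relabel_tppW_of_sectorFloors ![1, 2] (r := 2) (c := 3) (by decide) (by decide) f hf0 hf1 ω τ hτ
    υ ν (t'' / 2) (σ := σ) (fun k hk => hF k (by omega)) μ m (fun k hk => hm k (by omega))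
  have h2 := le_re_expect_relabel_tppW_of_sectorFloors ![2, 1] (r := 3) (c := 2) (by decide) (by decide) g hg0 hg1 ω _ hτ's
    (fun p => υ (rectSwap 3 2 p)) (fun p => ν (rectSwap 3 2 p)) (t'' / 2) (σ := σ)
    (fun k hk => hF' k (by omega)) μ m (fun k hk => hm k (by omega))
  -- evaluate every term in the translation-invariant state `ω`
  rw [hω.re_expect_relabel_hubbardOpenBoxTT'W ![1, 2] f hf0 hf1 τ hτ υ ν, hω.expect_axial2_localHamiltonian (t'' / 2),
    hω.re_expect_totalNumber_eq_card_mul_density, card_rect23', hρ] at h1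
  rw [hω.re_expect_relabel_hubbardOpenBoxTT'W ![2, 1] g hg0 hg1 _ hτ's, hω.expect_axial2_localHamiltonian (t'' / 2),
    hω.re_expect_totalNumber_eq_card_mul_density, card_rect32', hρ] at h2
  simp only [Fin.sum_univ_two, cnt23_a0', cnt23_a1', cnt32_a0', cnt32_a1'] at h1 h2
  rw [wsumV_transpose, wsumH_transpose, wsumD₁_transpose, wsumD₂_transpose τ hτ, ← sum_rectSwap' υ, ← sum_rectSwap' ν] at h2
  -- the mean energy of `ω` through the same unit term densities
  have hid := hω.meanEnergy_tpp_two (wsumV τ + wsumH τ) (2 * wsumD₁ τ) t'' (2 * ∑ x, υ x)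
  rw [Fin.sum_univ_two, Fin.sum_univ_two, Fin.sum_univ_two] at hid
  rw [ω.expect_axial2_pair_eq_mul (t'' / 2) 0, ω.expect_axial2_pair_eq_mul (t'' / 2) 1] at h1 h2
  -- name the unit term densities
  set D := ω.expect {0} ((hubbardFermionInteraction 2 0 1).Φ {0}) with hD
  set K0 := ω.expect {0, 0 + unitVec 0} ((hubbardFermionInteraction 2 1 0).Φ {0, 0 + unitVec 0}) with hK0
  set K1 := ω.expect {0, 0 + unitVec 1} ((hubbardFermionInteraction 2 1 0).Φ {0, 0 + unitVec 1}) with hK1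
  set P0 := ω.expect {0, 0 + diagVec 0} ((diagHoppingFermionInteraction 1).Φ {0, 0 + diagVec 0}) with hP0
  set P1 := ω.expect {0, 0 + diagVec 1} ((diagHoppingFermionInteraction 1).Φ {0, 0 + diagVec 1}) with hP1
  set A0 := ω.expect {0, 0 + axial2Vec 0} ((axialRange2HoppingFermionInteraction 2 1).Φ {0, 0 + axial2Vec 0}) with hA0
  set A1 := ω.expect {0, 0 + axial2Vec 1} ((axialRange2HoppingFermionInteraction 2 1).Φ {0, 0 + axial2Vec 1}) with hA1
  simp only [Complex.add_re, Complex.mul_re, Complex.ofReal_re, Complex.ofReal_im, Complex.natCast_re, Complex.natCast_im,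
    zero_mul, sub_zero] at h1 h2 hid
  have e1 : wsumD₂ τ * P1.re = wsumD₁ τ * P1.re := by rw [show wsumD₂ τ = wsumD₁ τ by linarith]
  have e2 : (∑ x, ν x) * ρ = 0 := by rw [hν, zero_mul]
  rw [hid]
  ring_nf at h1 h2 e1 e2 ⊢
  linarith

/-- **`t'' = 0` bridge**: a kernel table for the weighted `t–t'` cluster `hubbardOpenBoxTT'W 2 3 τ υ ν` (the shape of the
weighted KLDL certificates; torus-side consumer `energyDensityTT'_ge_of_boxFloorsW_2x3`) bounds object M at `t'' = 0`
directly: `2m − 12μρ ≤ e^M(t,t',0,U; ρ)`. [cite: Anderson1951, eq. (2)] [cite: ValentiStolzeHirschfeld1991, §II] -/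
theorem tiGroundEnergyDensityAt_tpp_zero_ge_of_ttPrimeWTable {σ : ℕ → ℝ} {τ : Fin 2 ×ₗ Fin 3 → Fin 2 ×ₗ Fin 3 → ℝ}
    {υ ν : Fin 2 ×ₗ Fin 3 → ℝ} {t t' U : ℝ} (hτ : ∀ x y, τ x y = τ y x) (ht : wsumV τ + wsumH τ = t)
    (hD₁ : 2 * wsumD₁ τ = t') (hD₂ : 2 * wsumD₂ τ = t') (hU : 2 * ∑ x, υ x = U) (hν : ∑ x, ν x = 0)
    (hF : ∀ k ≤ 12, σ k ≤ groundEnergy (hubbardOpenBoxTT'W 2 3 τ υ ν) k)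
    (μ m : ℝ) (hm : ∀ k ≤ 12, m ≤ σ k + μ * k) {ρ : ℝ} (hρ0 : 0 < ρ) (hρ2 : ρ < 2) :
    2 * m - 12 * μ * ρ ≤ (hubbardTT'T''FermionInteraction t t' 0 U).tiGroundEnergyDensityAt 2 ρ := by
  refine tiGroundEnergyDensityAt_tpp_ge_of_boxFloorsW_2x3 hτ ht hD₁ hD₂ hU hν (fun k hk => ?_) μ m hm hρ0 hρ2
  rw [zero_div, hubbardOpenBoxTT'T''W_zero]
  exact hF k hk

end InfVolFermionState

end Literature.MathematicalPhysics.QuantumLattice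

end
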